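import Literature.Barriers.CriticalPhenomena.PlaquetteWalkHoleRootThinBoxTable
import HarnessLib

/-!
# Barrier catalogue (SAWScalingLimit): LAW L AT DISTANCE ONE — the cells below / above the hole and the root plaquette, in boxes

Leaf of `PlaquetteWalkHoleRootInteriorRingBoxes` (`not_killed_of_witnesses`, `rootedFace_hroot_boxMinus_cell`),
`PlaquetteWalkHoleRootRingOffWall` (`block_hroot_subset_boxMinus_of_bounds`), `PlaquetteWalkHoleRootRingThreeDoor` and
`PlaquetteWalkHoleRootThinBoxTable` (landed every-position witness blocks). Setting: the `m × n` box `boxMinus m n [h, c]`,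
hole `h`, root plaquette `(h.1 + 1, h.2)` rooted at `W`, far cell `(h.1 − 1, h.2)`; the four universal kill statements
`P₁ … P₄` of LAW L. The lane's LAW L so far classifies single removals at Chebyshev distance `≥ 2` from the hole
(`lawL_box_kills_iff`, `PlaquetteWalkHoleRootLawLClassification`) and the far cell's two doors at distance one
(`lawL_box_farSW_eq_zero`, `lawL_box_farNW_eq_zero`). This file settles the four remaining cells at distance ONE —
`holeS`, `rootS`, `holeN`, `rootN` (vertical domino holes and notches at the root plaquette): in the interior they kill
NOTHING (`lawL_box_near_not_killed`). §1: 4 kit-found witnesses (every landed under witness passes through `holeS`/`rootS`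
and every landed `w₁`-free under witness through `holeN`/`rootN` — the shortest wound walks hug the hole — so new, one row
wider excursions are needed), each with `decide` certificates and its every-position theorem (#878 pattern); §2: the
assembly.

Not in print; venture lane «pcv-sawmu», seat b-step0 gen 27 (DESIGN-next-g27 §2.5 «domino holes»; kit j295732).

References: A. Glazman, I. Manolescu, arXiv:1708.00395v3, §1 (Fig. 2, remark after eq. (1)), §2.1, §4.2, Lemma 2.1
[GlazmanManolescu2019]; A. Glazman, Electron. Commun. Probab. 20 (2015) no. 86, Lemma 3.1, proof pp. 6–7
[Glazman2015WeightedSAW]; R. Courant, H. Robbins, *What is Mathematics?* (1941/1958), Ch. V Appendix §2 (the even–odd rule)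
[CourantRobbins1958].
-/

noncomputable section

open Set Function Complex

namespace Literature.Barriers.CriticalPhenomena.PlaquetteWalk

open Literature.Probability.RandomPlanarGeometry.SAW.YangBaxter
open Real Complex

/-! ## §1 The new witnesses (reference root `w42 = (4, 2)`, hole `(3, 2)`, far cell `(2, 2)`) -/

section Witnesses

/-- Near-cell witness block `SU2`: the 26 cells of an under w₂-free wound witness (reference root `(4, 2)`, hole
`(3, 2)`, far cell `(2, 2)`) AVOIDING `holeS (3,1)`, `rootS (4,1)`; cells in `[1,6]×[-1,3]` (kit j295732 of the lane).
[cite: GlazmanManolescu2019, §2.1 (finite domains of faces)] -/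
def nearBlockSU242 : List Face := [(1,-1),(1,0),(1,1),(1,2),(2,-1),(2,0),(2,1),(2,2),(2,3),(3,-1),(3,0),(3,3),(4,-1),(4,0),(4,2),(4,3),(5,-1),(5,0),(5,1),(5,2),(5,3),(6,-1),(6,0),(6,1),(6,2),(6,3)]

/-- Its mid-edges (26 arcs). [cite: GlazmanManolescu2019, §1 (definition of the model), Fig. 1] -/
def nearSU2Mids : List MidEdge :=
  [.vert 4 2, .vert 5 2, .slant 5 2, .slant 5 1, .vert 5 0, .vert 4 0, .vert 3 0, .slant 2 1, .slant 2 2, .vert 2 2, .slant 1 2, .slant 1 1, .slant 1 0, .vert 2 (-1), .vert 3 (-1), .vert 4 (-1), .vert 5 (-1), .vert 6 (-1), .slant 6 0, .slant 6 1, .slant 6 2, .slant 6 3, .vert 6 3, .vert 5 3, .vert 4 3, .vert 3 3, .slant 2 3]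

/-- The witness as a walk of its block. [cite: GlazmanManolescu2019, §1 (definition of the model), Fig. 1] -/
def nearSU2Walk : YBWalk (dom nearBlockSU242) (w42.side .W) ((farW w42).side .N) where
  mids := nearSU2Mids
  head_eq := by decide
  getLast_eq := by decide
  nodup := by decide
  arc_mem := arc_mem_of_check (by decide)
  isChain := by decide
  noncross := noncross_of_check (by decide)

/-- The labelled witness. [cite: Glazman2015WeightedSAW, Lemma 3.1 (proof, pp. 6–7)] -/
def ωnearSU2 : ΩG (dom nearBlockSU242) (w42.side .W) (farW w42) := ⟨.N, nearSU2Walk⟩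

/-- Certificates: first hit `8`, `26` arcs, no later far-cell arc, first side `S`, w₂-free off the far cell, odd
eastern-ray count (`1`). [cite: Glazman2015WeightedSAW, Lemma 3.1 (proof, pp. 6–7)] [cite: CourantRobbins1958, Ch. V Appendix §2 (the even–odd rule)] -/
theorem ωnearSU2_cert : ωnearSU2.2.firstHitG = 8 ∧ ωnearSU2.2.arcs.length = 26 ∧
    (∀ j < 26, 8 < j → ωnearSU2.2.fc j ≠ farW w42) ∧ ωnearSU2.2.nth 8 = (farW w42).side .S ∧
    ωnearSU2.2.W2FreeOff (farW w42) ∧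
    Odd ((Finset.range 18).filter fun j => eastRayB w42 (ωnearSU2.2.nth (8 + j + 1)) = true).card := by
  refine ⟨by decide, by decide, by decide, by decide, by unfold YBWalk.W2FreeOff; decide, by decide⟩

/-- The block at the root plaquette `w`. [cite: GlazmanManolescu2019, §2.1, §4.2 (translation invariance)] -/
def nearBlockSU2 (w : Face) : List Face := nearBlockSU242.map (Face.shiftBy (refShift w))

/-- ★★★ The under w₂-free wound witness `SU2` at EVERY POSITION: any face list containing the translated block
carries a wound class-`B2a` under-walk at the far cell, w₂-free off it. [cite: GlazmanManolescu2019, §4.2 (translation invariance), Lemma 2.1]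
[cite: Glazman2015WeightedSAW, Lemma 3.1 (proof, pp. 6–7)] [cite: CourantRobbins1958, Ch. V Appendix §2 (the even–odd rule)] -/
theorem exists_under_W2FreeOff_of_nearBlockSU2 {Dl : List Face} {w : Face} (hB : ∀ c ∈ nearBlockSU2 w, c ∈ Dl)
    (hr : RootedFace (dom Dl) (w.side .W) (farW w)) (θ : ℝ) :
    ∃ (ω : ΩG (dom Dl) (w.side .W) (farW w)) (h : ω.IsB2a), ω.2.firstSideG = .S ∧
      ω.WE (fun _ => θ) ≠ excursionWinding θ ω.2.firstSideG (ω.z1 hr h) ω.1 ∧ ω.2.W2FreeOff (farW w) := by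
  have hB₀ := block42_mem_of_block_mem (B := nearBlockSU242) hB
  obtain ⟨hF, hn, hfc, hnth, hfree, hodd⟩ := ωnearSU2_cert
  let ω₀ : ΩG (dom (Dl.map (Face.shiftBy (-refShift w)))) (w42.side .W) (farW w42) :=
    ⟨.N, nearSU2Walk.mapDomain fun c hc => hB₀ c hc⟩
  have hF' : ω₀.2.firstHitG = 8 := hF
  have hn' : ω₀.2.arcs.length = 26 := hn
  have h₀ : ω₀.IsB2a := by
    refine ΩG.isB2a_of_forall_fc_ne (by rw [hF', hn']; omega) fun j hj1 hj2 => ?_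
    rw [hF'] at hj1
    rw [hn'] at hj2
    exact hfc j hj2 hj1
  have hM : ω₀.Mv = 18 := by unfold ΩG.Mv; rw [hF', hn']
  exact exists_wound_witness_shift (shiftBy_refShift_root w) (shiftBy_refShift_farW w) hr
    (fun γ r => γ.W2FreeOff r) (fun hm _ hf => YBWalk.W2FreeOff_of_mids_shift hm hf) ω₀ h₀
    (by rw [hF']; exact hnth) hfree (by rw [hM, hF']; exact hodd) θ

/-- Near-cell witness block `SO2`: the 19 cells of an over w₂-free wound witness (reference root `(4, 2)`, hole
`(3, 2)`, far cell `(2, 2)`) AVOIDING `holeS (3,1)`, `rootS (4,1)`; cells in `[1,5]×[0,4]` (kit j295732 of the lane).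
[cite: GlazmanManolescu2019, §2.1 (finite domains of faces)] -/
def nearBlockSO242 : List Face := [(1,2),(1,3),(2,0),(2,1),(2,2),(2,3),(2,4),(3,0),(3,3),(3,4),(4,0),(4,2),(4,3),(4,4),(5,0),(5,1),(5,2),(5,3),(5,4)]

/-- Its mid-edges (20 arcs). [cite: GlazmanManolescu2019, §1 (definition of the model), Fig. 1] -/
def nearSO2Mids : List MidEdge :=
  [.vert 4 2, .slant 4 3, .vert 4 3, .vert 3 3, .slant 2 3, .vert 2 2, .slant 1 3, .vert 2 3, .slant 2 4, .vert 3 4, .vert 4 4, .vert 5 4, .slant 5 4, .slant 5 3, .slant 5 2, .slant 5 1, .vert 5 0, .vert 4 0, .vert 3 0, .slant 2 1, .slant 2 2]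

/-- The witness as a walk of its block. [cite: GlazmanManolescu2019, §1 (definition of the model), Fig. 1] -/
def nearSO2Walk : YBWalk (dom nearBlockSO242) (w42.side .W) ((farW w42).side .S) where
  mids := nearSO2Mids
  head_eq := by decide
  getLast_eq := by decide
  nodup := by decide
  arc_mem := arc_mem_of_check (by decide)
  isChain := by decide
  noncross := noncross_of_check (by decide)

/-- The labelled witness. [cite: Glazman2015WeightedSAW, Lemma 3.1 (proof, pp. 6–7)] -/
def ωnearSO2 : ΩG (dom nearBlockSO242) (w42.side .W) (farW w42) := ⟨.S, nearSO2Walk⟩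

/-- Certificates: first hit `4`, `20` arcs, no later far-cell arc, first side `N`, w₂-free off the far cell, odd
eastern-ray count (`1`). [cite: Glazman2015WeightedSAW, Lemma 3.1 (proof, pp. 6–7)] [cite: CourantRobbins1958, Ch. V Appendix §2 (the even–odd rule)] -/
theorem ωnearSO2_cert : ωnearSO2.2.firstHitG = 4 ∧ ωnearSO2.2.arcs.length = 20 ∧
    (∀ j < 20, 4 < j → ωnearSO2.2.fc j ≠ farW w42) ∧ ωnearSO2.2.nth 4 = (farW w42).side .N ∧
    ωnearSO2.2.W2FreeOff (farW w42) ∧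
    Odd ((Finset.range 16).filter fun j => eastRayB w42 (ωnearSO2.2.nth (4 + j + 1)) = true).card := by
  refine ⟨by decide, by decide, by decide, by decide, by unfold YBWalk.W2FreeOff; decide, by decide⟩

/-- The block at the root plaquette `w`. [cite: GlazmanManolescu2019, §2.1, §4.2 (translation invariance)] -/
def nearBlockSO2 (w : Face) : List Face := nearBlockSO242.map (Face.shiftBy (refShift w))

/-- ★★★ The over w₂-free wound witness `SO2` at EVERY POSITION: any face list containing the translated block
carries a wound class-`B2a` over-walk at the far cell, w₂-free off it. [cite: GlazmanManolescu2019, §4.2 (translation invariance), Lemma 2.1]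
[cite: Glazman2015WeightedSAW, Lemma 3.1 (proof, pp. 6–7)] [cite: CourantRobbins1958, Ch. V Appendix §2 (the even–odd rule)] -/
theorem exists_over_W2FreeOff_of_nearBlockSO2 {Dl : List Face} {w : Face} (hB : ∀ c ∈ nearBlockSO2 w, c ∈ Dl)
    (hr : RootedFace (dom Dl) (w.side .W) (farW w)) (θ : ℝ) :
    ∃ (ω : ΩG (dom Dl) (w.side .W) (farW w)) (h : ω.IsB2a), ω.2.firstSideG = .N ∧
      ω.WE (fun _ => θ) ≠ excursionWinding θ ω.2.firstSideG (ω.z1 hr h) ω.1 ∧ ω.2.W2FreeOff (farW w) := by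
  have hB₀ := block42_mem_of_block_mem (B := nearBlockSO242) hB
  obtain ⟨hF, hn, hfc, hnth, hfree, hodd⟩ := ωnearSO2_cert
  let ω₀ : ΩG (dom (Dl.map (Face.shiftBy (-refShift w)))) (w42.side .W) (farW w42) :=
    ⟨.S, nearSO2Walk.mapDomain fun c hc => hB₀ c hc⟩
  have hF' : ω₀.2.firstHitG = 4 := hF
  have hn' : ω₀.2.arcs.length = 20 := hn
  have h₀ : ω₀.IsB2a := by
    refine ΩG.isB2a_of_forall_fc_ne (by rw [hF', hn']; omega) fun j hj1 hj2 => ?_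
    rw [hF'] at hj1
    rw [hn'] at hj2
    exact hfc j hj2 hj1
  have hM : ω₀.Mv = 16 := by unfold ΩG.Mv; rw [hF', hn']
  exact exists_wound_witness_shift (shiftBy_refShift_root w) (shiftBy_refShift_farW w) hr
    (fun γ r => γ.W2FreeOff r) (fun hm _ hf => YBWalk.W2FreeOff_of_mids_shift hm hf) ω₀ h₀
    (by rw [hF']; exact hnth) hfree (by rw [hM, hF']; exact hodd) θ

/-- Near-cell witness block `NU1`: the 19 cells of an under w₁-free wound witness (reference root `(4, 2)`, hole
`(3, 2)`, far cell `(2, 2)`) AVOIDING `holeN (3,3)`, `rootN (4,3)`; cells in `[1,5]×[0,4]` (kit j295732 of the lane).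
[cite: GlazmanManolescu2019, §2.1 (finite domains of faces)] -/
def nearBlockNU142 : List Face := [(1,1),(1,2),(2,0),(2,1),(2,2),(2,3),(2,4),(3,0),(3,1),(3,4),(4,0),(4,1),(4,2),(4,4),(5,0),(5,1),(5,2),(5,3),(5,4)]

/-- Its mid-edges (20 arcs). [cite: GlazmanManolescu2019, §1 (definition of the model), Fig. 1] -/
def nearNU1Mids : List MidEdge :=
  [.vert 4 2, .slant 4 2, .vert 4 1, .vert 3 1, .slant 2 2, .vert 2 2, .slant 1 2, .vert 2 1, .slant 2 1, .vert 3 0, .vert 4 0, .vert 5 0, .slant 5 1, .slant 5 2, .slant 5 3, .slant 5 4, .vert 5 4, .vert 4 4, .vert 3 4, .slant 2 4, .slant 2 3]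

/-- The witness as a walk of its block. [cite: GlazmanManolescu2019, §1 (definition of the model), Fig. 1] -/
def nearNU1Walk : YBWalk (dom nearBlockNU142) (w42.side .W) ((farW w42).side .N) where
  mids := nearNU1Mids
  head_eq := by decide
  getLast_eq := by decide
  nodup := by decide
  arc_mem := arc_mem_of_check (by decide)
  isChain := by decide
  noncross := noncross_of_check (by decide)

/-- The labelled witness. [cite: Glazman2015WeightedSAW, Lemma 3.1 (proof, pp. 6–7)] -/
def ωnearNU1 : ΩG (dom nearBlockNU142) (w42.side .W) (farW w42) := ⟨.N, nearNU1Walk⟩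

/-- Certificates: first hit `4`, `20` arcs, no later far-cell arc, first side `S`, w₁-free off the far cell, odd
eastern-ray count (`1`). [cite: Glazman2015WeightedSAW, Lemma 3.1 (proof, pp. 6–7)] [cite: CourantRobbins1958, Ch. V Appendix §2 (the even–odd rule)] -/
theorem ωnearNU1_cert : ωnearNU1.2.firstHitG = 4 ∧ ωnearNU1.2.arcs.length = 20 ∧
    (∀ j < 20, 4 < j → ωnearNU1.2.fc j ≠ farW w42) ∧ ωnearNU1.2.nth 4 = (farW w42).side .S ∧
    ωnearNU1.2.W1FreeOff (farW w42) ∧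
    Odd ((Finset.range 16).filter fun j => eastRayB w42 (ωnearNU1.2.nth (4 + j + 1)) = true).card := by
  refine ⟨by decide, by decide, by decide, by decide, by unfold YBWalk.W1FreeOff; decide, by decide⟩

/-- The block at the root plaquette `w`. [cite: GlazmanManolescu2019, §2.1, §4.2 (translation invariance)] -/
def nearBlockNU1 (w : Face) : List Face := nearBlockNU142.map (Face.shiftBy (refShift w))

/-- ★★★ The under w₁-free wound witness `NU1` at EVERY POSITION: any face list containing the translated block
carries a wound class-`B2a` under-walk at the far cell, w₁-free off it. [cite: GlazmanManolescu2019, §4.2 (translation invariance), Lemma 2.1]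
[cite: Glazman2015WeightedSAW, Lemma 3.1 (proof, pp. 6–7)] [cite: CourantRobbins1958, Ch. V Appendix §2 (the even–odd rule)] -/
theorem exists_under_W1FreeOff_of_nearBlockNU1 {Dl : List Face} {w : Face} (hB : ∀ c ∈ nearBlockNU1 w, c ∈ Dl)
    (hr : RootedFace (dom Dl) (w.side .W) (farW w)) (θ : ℝ) :
    ∃ (ω : ΩG (dom Dl) (w.side .W) (farW w)) (h : ω.IsB2a), ω.2.firstSideG = .S ∧
      ω.WE (fun _ => θ) ≠ excursionWinding θ ω.2.firstSideG (ω.z1 hr h) ω.1 ∧ ω.2.W1FreeOff (farW w) := by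
  have hB₀ := block42_mem_of_block_mem (B := nearBlockNU142) hB
  obtain ⟨hF, hn, hfc, hnth, hfree, hodd⟩ := ωnearNU1_cert
  let ω₀ : ΩG (dom (Dl.map (Face.shiftBy (-refShift w)))) (w42.side .W) (farW w42) :=
    ⟨.N, nearNU1Walk.mapDomain fun c hc => hB₀ c hc⟩
  have hF' : ω₀.2.firstHitG = 4 := hF
  have hn' : ω₀.2.arcs.length = 20 := hn
  have h₀ : ω₀.IsB2a := by
    refine ΩG.isB2a_of_forall_fc_ne (by rw [hF', hn']; omega) fun j hj1 hj2 => ?_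
    rw [hF'] at hj1
    rw [hn'] at hj2
    exact hfc j hj2 hj1
  have hM : ω₀.Mv = 16 := by unfold ΩG.Mv; rw [hF', hn']
  exact exists_wound_witness_shift (shiftBy_refShift_root w) (shiftBy_refShift_farW w) hr
    (fun γ r => γ.W1FreeOff r) (fun hm _ hf => YBWalk.W1FreeOff_of_mids_shift hm hf) ω₀ h₀
    (by rw [hF']; exact hnth) hfree (by rw [hM, hF']; exact hodd) θ

/-- Near-cell witness block `SU1`: the 24 cells of an under w₁-free wound witness (reference root `(4, 2)`, hole
`(3, 2)`, far cell `(2, 2)`) AVOIDING `holeS (3,1)`, `rootS (4,1)`; cells in `[1,6]×[-1,3]` (kit j295732 of the lane).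
[cite: GlazmanManolescu2019, §2.1 (finite domains of faces)] -/
def nearBlockSU142 : List Face := [(1,0),(1,1),(1,2),(2,-1),(2,0),(2,1),(2,2),(2,3),(3,-1),(3,0),(3,3),(4,-1),(4,0),(4,2),(4,3),(5,-1),(5,0),(5,1),(5,2),(5,3),(6,-1),(6,0),(6,1),(6,2)]

/-- Its mid-edges (26 arcs). [cite: GlazmanManolescu2019, §1 (definition of the model), Fig. 1] -/
def nearSU1Mids : List MidEdge :=
  [.vert 4 2, .vert 5 2, .slant 5 2, .slant 5 1, .vert 5 0, .vert 4 0, .vert 3 0, .slant 2 1, .slant 2 2, .vert 2 2, .slant 1 2, .slant 1 1, .vert 2 0, .slant 2 0, .vert 3 (-1), .vert 4 (-1), .vert 5 (-1), .vert 6 (-1), .slant 6 0, .slant 6 1, .slant 6 2, .vert 6 2, .slant 5 3, .vert 5 3, .vert 4 3, .vert 3 3, .slant 2 3]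

/-- The witness as a walk of its block. [cite: GlazmanManolescu2019, §1 (definition of the model), Fig. 1] -/
def nearSU1Walk : YBWalk (dom nearBlockSU142) (w42.side .W) ((farW w42).side .N) where
  mids := nearSU1Mids
  head_eq := by decide
  getLast_eq := by decide
  nodup := by decide
  arc_mem := arc_mem_of_check (by decide)
  isChain := by decide
  noncross := noncross_of_check (by decide)

/-- The labelled witness. [cite: Glazman2015WeightedSAW, Lemma 3.1 (proof, pp. 6–7)] -/
def ωnearSU1 : ΩG (dom nearBlockSU142) (w42.side .W) (farW w42) := ⟨.N, nearSU1Walk⟩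

/-- Certificates: first hit `8`, `26` arcs, no later far-cell arc, first side `S`, w₁-free off the far cell, odd
eastern-ray count (`1`). [cite: Glazman2015WeightedSAW, Lemma 3.1 (proof, pp. 6–7)] [cite: CourantRobbins1958, Ch. V Appendix §2 (the even–odd rule)] -/
theorem ωnearSU1_cert : ωnearSU1.2.firstHitG = 8 ∧ ωnearSU1.2.arcs.length = 26 ∧
    (∀ j < 26, 8 < j → ωnearSU1.2.fc j ≠ farW w42) ∧ ωnearSU1.2.nth 8 = (farW w42).side .S ∧
    ωnearSU1.2.W1FreeOff (farW w42) ∧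
    Odd ((Finset.range 18).filter fun j => eastRayB w42 (ωnearSU1.2.nth (8 + j + 1)) = true).card := by
  refine ⟨by decide, by decide, by decide, by decide, by unfold YBWalk.W1FreeOff; decide, by decide⟩

/-- The block at the root plaquette `w`. [cite: GlazmanManolescu2019, §2.1, §4.2 (translation invariance)] -/
def nearBlockSU1 (w : Face) : List Face := nearBlockSU142.map (Face.shiftBy (refShift w))

/-- ★★★ The under w₁-free wound witness `SU1` at EVERY POSITION: any face list containing the translated block
carries a wound class-`B2a` under-walk at the far cell, w₁-free off it. [cite: GlazmanManolescu2019, §4.2 (translation invariance), Lemma 2.1]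
[cite: Glazman2015WeightedSAW, Lemma 3.1 (proof, pp. 6–7)] [cite: CourantRobbins1958, Ch. V Appendix §2 (the even–odd rule)] -/
theorem exists_under_W1FreeOff_of_nearBlockSU1 {Dl : List Face} {w : Face} (hB : ∀ c ∈ nearBlockSU1 w, c ∈ Dl)
    (hr : RootedFace (dom Dl) (w.side .W) (farW w)) (θ : ℝ) :
    ∃ (ω : ΩG (dom Dl) (w.side .W) (farW w)) (h : ω.IsB2a), ω.2.firstSideG = .S ∧
      ω.WE (fun _ => θ) ≠ excursionWinding θ ω.2.firstSideG (ω.z1 hr h) ω.1 ∧ ω.2.W1FreeOff (farW w) := by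
  have hB₀ := block42_mem_of_block_mem (B := nearBlockSU142) hB
  obtain ⟨hF, hn, hfc, hnth, hfree, hodd⟩ := ωnearSU1_cert
  let ω₀ : ΩG (dom (Dl.map (Face.shiftBy (-refShift w)))) (w42.side .W) (farW w42) :=
    ⟨.N, nearSU1Walk.mapDomain fun c hc => hB₀ c hc⟩
  have hF' : ω₀.2.firstHitG = 8 := hF
  have hn' : ω₀.2.arcs.length = 26 := hn
  have h₀ : ω₀.IsB2a := by
    refine ΩG.isB2a_of_forall_fc_ne (by rw [hF', hn']; omega) fun j hj1 hj2 => ?_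
    rw [hF'] at hj1
    rw [hn'] at hj2
    exact hfc j hj2 hj1
  have hM : ω₀.Mv = 18 := by unfold ΩG.Mv; rw [hF', hn']
  exact exists_wound_witness_shift (shiftBy_refShift_root w) (shiftBy_refShift_farW w) hr
    (fun γ r => γ.W1FreeOff r) (fun hm _ hf => YBWalk.W1FreeOff_of_mids_shift hm hf) ω₀ h₀
    (by rw [hF']; exact hnth) hfree (by rw [hM, hF']; exact hodd) θ

end Witnesses

/-! ## §2 The four near cells kill nothing in the interior -/

section NearCells

variable {m n : ℕ} {h : Face}

/-- ★★★★★ **LAW L AT DISTANCE ONE: the cells BELOW and ABOVE the hole and the root plaquette kill NOTHING in the interior.**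
In the `m × n` box with the hole `h` at distance `≥ 2` from the west wall, `≥ 3` from the bottom wall, with `h.1 + 4 ≤ m`
and `h.2 + 4 ≤ n`, remove the hole and ONE of the four cells `holeS = (h.1, h.2 − 1)`, `rootS = (h.1 + 1, h.2 − 1)`,
`holeN = (h.1, h.2 + 1)`, `rootN = (h.1 + 1, h.2 + 1)` (a vertical domino hole, or a notch under / over the root plaquette).
Then at every angle NONE of the four universal kill statements of LAW L holds at the far cell of the root plaquette
`(h.1 + 1, h.2)`: wound class-`B2a` walks of all four kinds survive — by landed every-position blocks that happen to avoid
the cell (`ringBlockUS2a`, `ringBlockON1a` of `PlaquetteWalkHoleRootRingThreeDoor`; `thinBlockON2hr`, `thinBlockON1hr` of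
`PlaquetteWalkHoleRootThinBoxTable`) and by the 4 new witnesses of §1 (kit j295732). Table (reference coordinates,
hole `(3, 2)`; under `w₂`-free · over `w₁`-free · under `w₁`-free · over `w₂`-free): `holeS (3,1)`: SU2 · ON1a · SU1 · SO2;
`rootS (4,1)`: SU2 · ON1a · SU1 · SO2; `holeN (3,3)`: US2a · TON1hr · NU1 · TON2hr; `rootN (4,3)`: US2a · TON1hr · NU1 · TON2hr. (The remaining cells at distance one:
the far cell itself and the root plaquette are part of the frame; the far cell's doors `farSW`, `farNW` give `VF ≡ 0`,
`lawL_box_farSW_eq_zero` / `lawL_box_farNW_eq_zero`; with `lawL_box_kills_iff` (distance `≥ 2`) this completes LAW L for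
single removals in the interior.) [cite: GlazmanManolescu2019, §1 (Fig. 2 and the remark after eq. (1)), §2.1, §4.2, Lemma 2.1]
[cite: Glazman2015WeightedSAW, Lemma 3.1 (proof, pp. 6–7)] [cite: CourantRobbins1958, Ch. V Appendix §2 (the even–odd rule)] -/
theorem lawL_box_near_not_killed (hW : 2 ≤ h.1) (hE : h.1 + 4 ≤ m) (hS : 3 ≤ h.2) (hN : h.2 + 4 ≤ n) {x y : ℤ}
    (hnear : (x = h.1 ∨ x = h.1 + 1) ∧ (y = h.2 - 1 ∨ y = h.2 + 1))
    (hr : RootedFace (dom (boxMinus m n [h, (x, y)])) (Face.side (h.1 + 1, h.2) .W) (farW (h.1 + 1, h.2))) (θ : ℝ) :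
    (¬ ∀ (ω : ΩG (dom (boxMinus m n [h, (x, y)])) (Face.side (h.1 + 1, h.2) .W) (farW (h.1 + 1, h.2))) (hb : ω.IsB2a),
        ω.2.firstSideG = .S → ω.WE (fun _ => θ) ≠ excursionWinding θ ω.2.firstSideG (ω.z1 hr hb) ω.1 →
          ¬ω.2.W2FreeOff (farW (h.1 + 1, h.2))) ∧
      (¬ ∀ (ω : ΩG (dom (boxMinus m n [h, (x, y)])) (Face.side (h.1 + 1, h.2) .W) (farW (h.1 + 1, h.2))) (hb : ω.IsB2a),
        ω.2.firstSideG = .N → ω.WE (fun _ => θ) ≠ excursionWinding θ ω.2.firstSideG (ω.z1 hr hb) ω.1 →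
          ¬ω.2.W1FreeOff (farW (h.1 + 1, h.2))) ∧
      (¬ ∀ (ω : ΩG (dom (boxMinus m n [h, (x, y)])) (Face.side (h.1 + 1, h.2) .W) (farW (h.1 + 1, h.2))) (hb : ω.IsB2a),
        ω.2.firstSideG = .S → ω.WE (fun _ => θ) ≠ excursionWinding θ ω.2.firstSideG (ω.z1 hr hb) ω.1 →
          ¬ω.2.W1FreeOff (farW (h.1 + 1, h.2))) ∧
      (¬ ∀ (ω : ΩG (dom (boxMinus m n [h, (x, y)])) (Face.side (h.1 + 1, h.2) .W) (farW (h.1 + 1, h.2))) (hb : ω.IsB2a),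
        ω.2.firstSideG = .N → ω.WE (fun _ => θ) ≠ excursionWinding θ ω.2.firstSideG (ω.z1 hr hb) ω.1 →
          ¬ω.2.W2FreeOff (farW (h.1 + 1, h.2))) := by
  have sub := block_hroot_subset_boxMinus_of_bounds (m := m) (n := n) (h := h)
  obtain ⟨hx, hy⟩ := hnear
  rcases hy with rfl | rfl <;> rcases hx with rfl | rfl
  -- holeS (3,1) · rootS (4,1)
  · exact not_killed_of_witnesses hr θ
      (exists_under_W2FreeOff_of_nearBlockSU2 (sub nearBlockSU242 1 6 (-1) 3 3 1 (by decide) (by omega) (by omega)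
        (by omega) (by omega) ⟨by omega, by omega⟩) hr θ)
      (exists_over_W1FreeOff_of_ringBlockON1a (sub ringBlockON1a42 1 6 0 4 3 1 (by decide) (by omega) (by omega)
        (by omega) (by omega) ⟨by omega, by omega⟩) hr θ)
      (exists_under_W1FreeOff_of_nearBlockSU1 (sub nearBlockSU142 1 6 (-1) 3 3 1 (by decide) (by omega) (by omega)
        (by omega) (by omega) ⟨by omega, by omega⟩) hr θ)
      (exists_over_W2FreeOff_of_nearBlockSO2 (sub nearBlockSO242 1 5 0 4 3 1 (by decide) (by omega) (by omega)
        (by omega) (by omega) ⟨by omega, by omega⟩) hr θ)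
  · exact not_killed_of_witnesses hr θ
      (exists_under_W2FreeOff_of_nearBlockSU2 (sub nearBlockSU242 1 6 (-1) 3 4 1 (by decide) (by omega) (by omega)
        (by omega) (by omega) ⟨by omega, by omega⟩) hr θ)
      (exists_over_W1FreeOff_of_ringBlockON1a (sub ringBlockON1a42 1 6 0 4 4 1 (by decide) (by omega) (by omega)
        (by omega) (by omega) ⟨by omega, by omega⟩) hr θ)
      (exists_under_W1FreeOff_of_nearBlockSU1 (sub nearBlockSU142 1 6 (-1) 3 4 1 (by decide) (by omega) (by omega)
        (by omega) (by omega) ⟨by omega, by omega⟩) hr θ)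
      (exists_over_W2FreeOff_of_nearBlockSO2 (sub nearBlockSO242 1 5 0 4 4 1 (by decide) (by omega) (by omega)
        (by omega) (by omega) ⟨by omega, by omega⟩) hr θ)
  -- holeN (3,3) · rootN (4,3)
  · exact not_killed_of_witnesses hr θ
      (exists_under_W2FreeOff_of_ringBlockUS2a (sub ringBlockUS2a42 1 6 0 4 3 3 (by decide) (by omega) (by omega)
        (by omega) (by omega) ⟨by omega, by omega⟩) hr θ)
      (exists_over_W1FreeOff_of_thinBlockON1hr (sub thinBlockON1hr42 1 6 1 5 3 3 (by decide) (by omega) (by omega)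
        (by omega) (by omega) ⟨by omega, by omega⟩) hr θ)
      (exists_under_W1FreeOff_of_nearBlockNU1 (sub nearBlockNU142 1 5 0 4 3 3 (by decide) (by omega) (by omega)
        (by omega) (by omega) ⟨by omega, by omega⟩) hr θ)
      (exists_over_W2FreeOff_of_thinBlockON2hr (sub thinBlockON2hr42 1 6 1 5 3 3 (by decide) (by omega) (by omega)
        (by omega) (by omega) ⟨by omega, by omega⟩) hr θ)
  · exact not_killed_of_witnesses hr θ
      (exists_under_W2FreeOff_of_ringBlockUS2a (sub ringBlockUS2a42 1 6 0 4 4 3 (by decide) (by omega) (by omega)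
        (by omega) (by omega) ⟨by omega, by omega⟩) hr θ)
      (exists_over_W1FreeOff_of_thinBlockON1hr (sub thinBlockON1hr42 1 6 1 5 4 3 (by decide) (by omega) (by omega)
        (by omega) (by omega) ⟨by omega, by omega⟩) hr θ)
      (exists_under_W1FreeOff_of_nearBlockNU1 (sub nearBlockNU142 1 5 0 4 4 3 (by decide) (by omega) (by omega)
        (by omega) (by omega) ⟨by omega, by omega⟩) hr θ)
      (exists_over_W2FreeOff_of_thinBlockON2hr (sub thinBlockON2hr42 1 6 1 5 4 3 (by decide) (by omega) (by omega)
        (by omega) (by omega) ⟨by omega, by omega⟩) hr θ)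

/-- ★★★★ The same with the rooting hypothesis discharged (`rootedFace_hroot_boxMinus_cell`).
[cite: GlazmanManolescu2019, §1 (Fig. 2 and the remark after eq. (1)), §2.1, §4.2, Lemma 2.1] [cite: Glazman2015WeightedSAW, Lemma 3.1 (proof, pp. 6–7)] -/
theorem lawL_box_near_not_killed' (hW : 2 ≤ h.1) (hE : h.1 + 4 ≤ m) (hS : 3 ≤ h.2) (hN : h.2 + 4 ≤ n) {x y : ℤ}
    (hnear : (x = h.1 ∨ x = h.1 + 1) ∧ (y = h.2 - 1 ∨ y = h.2 + 1)) (θ : ℝ) :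
    let hr : RootedFace (dom (boxMinus m n [h, (x, y)])) (Face.side (h.1 + 1, h.2) .W) (farW (h.1 + 1, h.2)) :=
      rootedFace_hroot_boxMinus_cell (by omega) (by omega) (by omega) (by omega) (by omega)
    (¬ ∀ (ω : ΩG (dom (boxMinus m n [h, (x, y)])) (Face.side (h.1 + 1, h.2) .W) (farW (h.1 + 1, h.2))) (hb : ω.IsB2a),
        ω.2.firstSideG = .S → ω.WE (fun _ => θ) ≠ excursionWinding θ ω.2.firstSideG (ω.z1 hr hb) ω.1 →
          ¬ω.2.W2FreeOff (farW (h.1 + 1, h.2))) ∧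
      (¬ ∀ (ω : ΩG (dom (boxMinus m n [h, (x, y)])) (Face.side (h.1 + 1, h.2) .W) (farW (h.1 + 1, h.2))) (hb : ω.IsB2a),
        ω.2.firstSideG = .N → ω.WE (fun _ => θ) ≠ excursionWinding θ ω.2.firstSideG (ω.z1 hr hb) ω.1 →
          ¬ω.2.W1FreeOff (farW (h.1 + 1, h.2))) ∧
      (¬ ∀ (ω : ΩG (dom (boxMinus m n [h, (x, y)])) (Face.side (h.1 + 1, h.2) .W) (farW (h.1 + 1, h.2))) (hb : ω.IsB2a),
        ω.2.firstSideG = .S → ω.WE (fun _ => θ) ≠ excursionWinding θ ω.2.firstSideG (ω.z1 hr hb) ω.1 →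
          ¬ω.2.W1FreeOff (farW (h.1 + 1, h.2))) ∧
      (¬ ∀ (ω : ΩG (dom (boxMinus m n [h, (x, y)])) (Face.side (h.1 + 1, h.2) .W) (farW (h.1 + 1, h.2))) (hb : ω.IsB2a),
        ω.2.firstSideG = .N → ω.WE (fun _ => θ) ≠ excursionWinding θ ω.2.firstSideG (ω.z1 hr hb) ω.1 →
          ¬ω.2.W2FreeOff (farW (h.1 + 1, h.2))) :=
  lawL_box_near_not_killed hW hE hS hN hnear _ θ

end NearCells

end Literature.Barriers.CriticalPhenomena.PlaquetteWalk
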